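import Summits.BirchSwinnertonDyer.BirchSwinnertonDyer.Theorems.Rank1ResidualJetPairingCounting
import Summits.BirchSwinnertonDyer.BirchSwinnertonDyer.Theorems.Rank1ResidualJetGlobalDualityLocal
import Literature.NumberTheory.GaloisRepresentations.LocalGlobalCohomologyFiniteProofs
import HarnessLib

/-!
# T1 JET (cell `bsd-jet`), road K: the ANNIHILATOR IDENTITY `(loc_T H¹_𝓖 + Π𝓕_v)^⊥ = loc_T H¹_{𝓕^*} + Π𝓖_v^*`
# behind Poitou–Tate counting, EXPOSED as a statement (the input `hann` of the split ∕ signed counting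
# theorems), together with the perfectness of the sum of the local Tate pairings over `T`

HONEST FRAMING (programme file `BSD-LIT2PART-PROGRAMME-v1.md` §HONESTY, verbatim): «no tranche here
proves BSD; ARM L moves the LITERAL column of an r ≤ 1 census into the kernel-proved-modulo-named-print
column; ARM P changes what «named print» is worth.» THEOREMS ONLY (seat `bsd-jet-pv-1`, session g3;
`--supports stmt-BirchSwinnertonDyer-14418`, helper): no definition, no named fact, no `sorry`.
Nothing is booked; 0 classes move. GENERIC Galois cohomology: no elliptic curve, no `p`-versus-`N`.

## Why

`GlobalDuality.relIndex_selmerGroup_mul_relIndex_dualSelmerGroup` (`Rank1ResidualJetGlobalDuality.lean`,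
p479216) proves the counting form of Poitou–Tate duality by establishing, INSIDE its proof, the
annihilator identity `(L + F)^⊥ = L' + G^⊥` on `X = Π_{v∈T} H¹(K_v, M)` for `F = Π 𝓕_v`, `G = Π 𝓖_v`,
`L = loc_T(H¹_𝓖)`, `L' = loc_T(H¹_{𝓕^*})`, and then calling the pure-algebra identity
`relIndex_mul_relIndex_eq_of_iInf_ker_sup`. The SIGN-BY-SIGN counting theorems
`GlobalDuality.relIndex_mul_relIndex_eq_of_iInf_ker_sup_plus ∕ _minus`
(`Rank1ResidualJetPairingCountingSigns.lean`, p480344) — the shape Jetchev 2008 Thm. 5.1 ∕ Lemma 5.2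
(iii) is used in (per `±`-eigenspace), i.e. the cell's `JET.Section6` hypotheses `horth_q`, `horth_ℓ` —
take that SAME identity as their hypothesis `hann`, plus an involution. So that the seat completing stub
S1 (complex conjugation on `H¹(K, E[p^m])` and on `⊕_v H¹(K_v, E[p^m])`) does not have to re-open a
proof, this file states the identity and the perfectness of the sum pairing as theorems, for ANY
bi-additive `bS` on `X × Y` given by the sum of the local Tate pairings (hypothesis `hbS`; no definition):

* `sum_localTatePairing_injective` ∕ `sum_localTatePairing_flip_injective` — both adjoints of
  `bS = ∑_{v∈T} ⟨·,·⟩_v` are injective (`IsPerfect` termwise);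
* `iInf_ker_pi_eq_pi_dual` — `(Π_{v∈T} 𝓛_v)^⊥ = Π_{v∈T} 𝓛_v^*` for every Selmer structure `𝓛`;
* `iInf_ker_map_sup_pi_eq` — **`(loc_T(H¹_𝓖) + Π𝓕_v)^⊥ = loc_T(H¹_{𝓕^*}) + Π𝓖_v^*`** for `𝓕 ≤ 𝓖`
  unramified outside `S` (finite places `T`), equal at the infinite places (`⊇`: Poitou–Tate vanishing
  `SumLocalTermEqZero`; `⊆`: `SelmerComplement` (ii)) — Howard 2004 Thm. 2.1.11 «the images … are exact
  orthogonal complements», as ONE equality of subgroups of `Y = Π_{v∈T} H¹(K_v, M^D)`.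

References (locators only; no cited FACT is declared): [cite: Howard2004HeegnerKolyvagin, Thm. 2.1.11
(arXiv:1202.6340 p. 6)] [cite: MilneADT2006, Ch. I, Thm. 4.10(b), Cor. 2.3] [cite: Jetchev2008, Thm. 5.1
(p. 822)]. Design: no definitions; universe `u` for `K`, `M`. Axioms: `propext`, `Classical.choice`,
`Quot.sound`.
-/

set_option autoImplicit false

noncomputable section

open scoped Classical
open Function NumberField IsDedekindDomain
open Literature.NumberTheory.GaloisRepresentations

universe u

namespace Summit.BirchSwinnertonDyer.Rank1Residual.JET.GlobalDuality

section Annihilator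

open Literature.NumberTheory.GaloisCohomology
open Literature.NumberTheory.GaloisRepresentations.DiscreteGaloisModule (localTatePairingZMod
  tateDual SelmerStructure)

variable {K : Type u} [Field K] [NumberField K] {n : ℕ} {M : Type u} [AddCommGroup M]
  [TopologicalSpace M] [DiscreteTopology M] [Finite M] {ρ : DiscreteGaloisModule K M}
  (inv : LocalInvariants K n) (T : Finset (HeightOneSpectrum (𝓞 K)))
  (bS : (∀ t : T, galoisCohomology (ρ.toLocal (Sum.inr (t : HeightOneSpectrum (𝓞 K)))) 1) →+
    (∀ t : T, galoisCohomology ((ρ.tateDual n).toLocal (Sum.inr (t : HeightOneSpectrum (𝓞 K)))) 1) →+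
      ZMod n)
  (hbS : ∀ x y, bS x y = ∑ t : T, localTatePairingZMod ρ n (Sum.inr (t : HeightOneSpectrum (𝓞 K)))
    (inv (Sum.inr (t : HeightOneSpectrum (𝓞 K)))) (x t) (y t))
include hbS

/-- Both adjoints of the sum of the local Tate pairings over `T` are injective when the family `inv`
has local Tate duality at the finite places (`IsPerfect`) — left adjoint.
[cite: MilneADT2006, Ch. I, Cor. 2.3] -/
theorem sum_localTatePairing_injective (hperf : inv.IsPerfect) (hM : ∀ m : M, n • m = 0) :
    Injective bS :=
  sum_pairing_injective (fun t : T => localTatePairingZMod ρ n (Sum.inr (t : HeightOneSpectrum (𝓞 K)))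
    (inv (Sum.inr (t : HeightOneSpectrum (𝓞 K))))) bS hbS fun t => ((hperf t).2 ρ hM).1.injective

/-- Right adjoint of the sum of the local Tate pairings over `T` is injective (`IsPerfect`).
[cite: MilneADT2006, Ch. I, Cor. 2.3] -/
theorem sum_localTatePairing_flip_injective (hperf : inv.IsPerfect) (hM : ∀ m : M, n • m = 0) :
    Injective bS.flip :=
  sum_pairing_flip_injective (fun t : T => localTatePairingZMod ρ n
    (Sum.inr (t : HeightOneSpectrum (𝓞 K))) (inv (Sum.inr (t : HeightOneSpectrum (𝓞 K))))) bS hbS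
    fun t => ((hperf t).2 ρ hM).2.injective

/-- **`(Π_{v∈T} 𝓛_v)^⊥ = Π_{v∈T} 𝓛_v^*`**: the annihilator of a product of local conditions under the
sum pairing is the product of the dual local conditions (Howard Def. 2.1.6 termwise).
[cite: Howard2004HeegnerKolyvagin, Def. 2.1.6 (arXiv:1202.6340 p. 5)] -/
theorem iInf_ker_pi_eq_pi_dual (𝓛 : SelmerStructure ρ) :
    (⨅ s ∈ AddSubgroup.pi Set.univ (fun t : T => 𝓛 (Sum.inr (t : HeightOneSpectrum (𝓞 K)))),
        (bS s).ker : AddSubgroup _) =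
      AddSubgroup.pi Set.univ fun t : T =>
        inv.dualSelmerStructure ρ 𝓛 (Sum.inr (t : HeightOneSpectrum (𝓞 K))) := by
  rw [iInf_ker_pi_eq (fun t : T => localTatePairingZMod ρ n (Sum.inr (t : HeightOneSpectrum (𝓞 K)))
    (inv (Sum.inr (t : HeightOneSpectrum (𝓞 K))))) bS hbS]
  congr 1
  funext t
  ext c
  rw [mem_iInf_ker_iff, LocalInvariants.dualSelmerStructure_apply,
    LocalInvariants.mem_dualLocalCondition_iff]

/-- **The annihilator identity of Poitou–Tate counting, as a statement**: for `𝓕 ≤ 𝓖` unramified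
outside `S` (finite places `T`), equal at the infinite places, and a family `inv` with
`SumLocalTermEqZero` and `SelmerComplement`,
`(loc_T(H¹_𝓖) + Π_{v∈T} 𝓕_v)^⊥ = loc_T(H¹_{𝓕^*}) + Π_{v∈T} 𝓖_v^*` inside `Π_{v∈T} H¹(K_v, M^D)` — Howard's
«the images … are exact orthogonal complements» (Thm. 2.1.11) as one equality of subgroups; the
hypothesis `hann` of `relIndex_mul_relIndex_eq_of_iInf_ker_sup[_of_split ∕ _plus ∕ _minus]` with
`F = Π𝓕_v`, `G = Π𝓖_v` (whose annihilator is `Π𝓖_v^*`, `iInf_ker_pi_eq_pi_dual`), `L = loc_T(H¹_𝓖)`,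
`L' = loc_T(H¹_{𝓕^*})`. [cite: Howard2004HeegnerKolyvagin, Thm. 2.1.11 (arXiv:1202.6340 p. 6)]
[cite: MilneADT2006, Ch. I, Thm. 4.10(b)] -/
theorem iInf_ker_map_sup_pi_eq (hvan : inv.SumLocalTermEqZero) (hSC : inv.SelmerComplement)
    (hM : ∀ m : M, n • m = 0) (S : Finset (Place K))
    (hT : ∀ v, (Sum.inr v : Place K) ∈ S ↔ v ∈ T)
    (hS : ∀ v : HeightOneSpectrum (𝓞 K), (Sum.inr v : Place K) ∉ S →
      ((n : ℕ) : 𝓞 K) ∉ v.asIdeal ∧ GaloisRep.IsUnramifiedAt v ρ)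
    {𝓕 𝓖 : SelmerStructure ρ} (hle : 𝓕 ≤ 𝓖) (h𝓕 : 𝓕.IsUnramifiedOutside S)
    (h𝓖 : 𝓖.IsUnramifiedOutside S)
    (hinf : ∀ w : InfinitePlace K, 𝓕 (Sum.inl w) = 𝓖 (Sum.inl w)) :
    (⨅ s ∈ 𝓖.selmerGroup.map (AddMonoidHom.pi fun t : T =>
          galoisCohomology.localization ρ (Sum.inr (t : HeightOneSpectrum (𝓞 K))) 1) ⊔
        AddSubgroup.pi Set.univ (fun t : T => 𝓕 (Sum.inr (t : HeightOneSpectrum (𝓞 K)))),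
        (bS s).ker : AddSubgroup _) =
      (inv.dualSelmerStructure ρ 𝓕).selmerGroup.map (AddMonoidHom.pi fun t : T =>
          galoisCohomology.localization (ρ.tateDual n) (Sum.inr (t : HeightOneSpectrum (𝓞 K))) 1) ⊔
        AddSubgroup.pi Set.univ fun t : T =>
          inv.dualSelmerStructure ρ 𝓖 (Sum.inr (t : HeightOneSpectrum (𝓞 K))) := by
  set b : ∀ t : T, galoisCohomology (ρ.toLocal (Sum.inr (t : HeightOneSpectrum (𝓞 K)))) 1 →+
      galoisCohomology ((ρ.tateDual n).toLocal (Sum.inr (t : HeightOneSpectrum (𝓞 K)))) 1 →+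
        ZMod n :=
    fun t => localTatePairingZMod ρ n (Sum.inr (t : HeightOneSpectrum (𝓞 K)))
      (inv (Sum.inr (t : HeightOneSpectrum (𝓞 K)))) with hb
  set locT := AddMonoidHom.pi fun t : T =>
    galoisCohomology.localization ρ (Sum.inr (t : HeightOneSpectrum (𝓞 K))) 1 with hlocT
  set locT' := AddMonoidHom.pi fun t : T =>
    galoisCohomology.localization (ρ.tateDual n) (Sum.inr (t : HeightOneSpectrum (𝓞 K))) 1
    with hlocT'
  have hlocT_apply : ∀ x (t : T), locT x t =
      galoisCohomology.localization ρ (Sum.inr (t : HeightOneSpectrum (𝓞 K))) 1 x :=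
    fun x t => by rw [hlocT, AddMonoidHom.pi_apply]
  have hlocT'_apply : ∀ y (t : T), locT' y t =
      galoisCohomology.localization (ρ.tateDual n) (Sum.inr (t : HeightOneSpectrum (𝓞 K))) 1 y :=
    fun y t => by rw [hlocT', AddMonoidHom.pi_apply]
  set F := AddSubgroup.pi Set.univ fun t : T => 𝓕 (Sum.inr (t : HeightOneSpectrum (𝓞 K))) with hF
  set G' := AddSubgroup.pi Set.univ fun t : T =>
    inv.dualSelmerStructure ρ 𝓖 (Sum.inr (t : HeightOneSpectrum (𝓞 K))) with hG'
  have hannF : (⨅ s ∈ F, (bS s).ker : AddSubgroup _) = AddSubgroup.pi Set.univ fun t : T =>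
      inv.dualSelmerStructure ρ 𝓕 (Sum.inr (t : HeightOneSpectrum (𝓞 K))) :=
    iInf_ker_pi_eq_pi_dual inv T bS hbS 𝓕
  apply le_antisymm
  · intro u hu
    rw [mem_iInf_ker_iff] at hu
    have huF : ∀ t : T,
        u t ∈ inv.dualSelmerStructure ρ 𝓕 (Sum.inr (t : HeightOneSpectrum (𝓞 K))) := by
      have hu' : u ∈ (⨅ s ∈ F, (bS s).ker : AddSubgroup _) :=
        (mem_iInf_ker_iff bS F u).mpr fun s hs => hu s (AddSubgroup.mem_sup_right hs)
      rw [hannF] at hu'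
      exact fun t => (AddSubgroup.mem_pi _).mp hu' t (Set.mem_univ _)
    have husum : ∀ x ∈ 𝓖.selmerGroup,
        ∑ t : T, b t (galoisCohomology.localization ρ
          (Sum.inr (t : HeightOneSpectrum (𝓞 K))) 1 x) (u t) = 0 := by
      intro x hx
      have h := hu (locT x) (AddSubgroup.mem_sup_left ⟨x, hx, rfl⟩)
      rw [hbS] at h
      simpa only [hlocT_apply] using h
    obtain ⟨y, hy, hyu⟩ := exists_mem_dualSelmerGroup_of_forall_sum_eq_zero hSC hM S T hT hS
      hle h𝓕 h𝓖 u huF husum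
    have hsplit : u = locT' y + (u - locT' y) := by abel
    rw [hsplit]
    refine AddSubgroup.add_mem_sup ⟨y, hy, rfl⟩ ?_
    refine (AddSubgroup.mem_pi _).mpr fun t _ => ?_
    have := neg_mem (hyu t)
    rw [neg_sub] at this
    simpa only [Pi.sub_apply, hlocT'_apply] using this
  · intro u hu
    obtain ⟨l', hl', g, hg, rfl⟩ := AddSubgroup.mem_sup.mp hu
    obtain ⟨y, hy, rfl⟩ := hl'
    rw [mem_iInf_ker_iff]
    intro s hs
    obtain ⟨l, hl, f, hf, rfl⟩ := AddSubgroup.mem_sup.mp hs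
    obtain ⟨x, hx, rfl⟩ := hl
    have hx' : ∀ v, galoisCohomology.localization ρ v 1 x ∈ 𝓖 v :=
      (SelmerStructure.mem_selmerGroup_iff _ _).mp hx
    have hy' : ∀ v, galoisCohomology.localization (ρ.tateDual n) v 1 y ∈
        inv.dualSelmerStructure ρ 𝓕 v :=
      (SelmerStructure.mem_selmerGroup_iff _ _).mp hy
    have hg' : ∀ t : T, g t ∈ inv.dualSelmerStructure ρ 𝓖 (Sum.inr (t : HeightOneSpectrum (𝓞 K))) :=
      fun t => (AddSubgroup.mem_pi _).mp hg t (Set.mem_univ _)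
    have hf' : ∀ t : T, f t ∈ 𝓕 (Sum.inr (t : HeightOneSpectrum (𝓞 K))) :=
      fun t => (AddSubgroup.mem_pi _).mp hf t (Set.mem_univ _)
    have h1 : bS (locT x) (locT' y) = 0 := by
      rw [hbS, ← sum_localTatePairingZMod_selmer_eq_zero hvan hM S T hT h𝓕 h𝓖 hinf hx hy,
        ← Finset.sum_coe_sort T]
      exact Finset.sum_congr rfl fun t _ => by rw [hlocT_apply, hlocT'_apply]
    have h2 : bS (locT x) g = 0 := by
      rw [hbS]
      exact Finset.sum_eq_zero fun t _ => by
        rw [hlocT_apply]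
        exact (LocalInvariants.mem_dualLocalCondition_iff _ _ _ _ _).mp (hg' t) _ (hx' _)
    have h3 : bS f (locT' y) = 0 := by
      rw [hbS]
      exact Finset.sum_eq_zero fun t _ => by
        rw [hlocT'_apply]
        exact (LocalInvariants.mem_dualLocalCondition_iff _ _ _ _ _).mp (hy' _) _ (hf' t)
    have h4 : bS f g = 0 := by
      rw [hbS]
      exact Finset.sum_eq_zero fun t _ =>
        (LocalInvariants.mem_dualLocalCondition_iff _ _ _ _ _).mp (hg' t) _ (hle _ (hf' t))
    rw [map_add, map_add, AddMonoidHom.add_apply, AddMonoidHom.add_apply, h1, h2, h3, h4,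
      add_zero, add_zero]

end Annihilator

end Summit.BirchSwinnertonDyer.Rank1Residual.JET.GlobalDuality

end
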